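import Summits.MatrixMultiplication.MatrixMultiplication.Theorems.SoloBlindHypergraphThree

/-!
# The degree-2 reduction lemma for admissible hypergraphs

Sub-programme (K₃), finite form (♣) (`SoloBlindHypergraph`).  For an admissible hypergraph `(F, P)`:

* `soloBlind_hg_strongSep`: for every ORDERED pair `u ≠ w` of vertices some edge contains `u` and not `w`
  (test functional `𝟙_u + 2·𝟙_w`, total `0`, plus separation);
* `soloBlind_hg_cover`: some edge contains both `u` and `w` (`2·𝟙_u + 2·𝟙_w`, total `1`);
* `soloBlind_hg_two_le_deg`: all degrees are `≥ 2` as soon as `|F| ≥ 2`;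
* `soloBlind_hg_degTwo_structure`: a vertex `v` of degree `2` has edges `A, B` with `A ∩ B = {v}`, `A ∪ B = F`;
* `soloBlind_hg_degTwo_admissible` (THE REDUCTION): then `(F ∖ {v}, P ∖ v)` — the edges avoiding `v` — is again
  admissible.  Since every `u ≠ v` lies in exactly one of `A, B`, `deg_P u = 1 + deg_{P∖v} u` and
  `K(P) = 1/4 + K(P∖v)/2`: the hypergraph Kraft inequality for `P` is equivalent to the one for `P ∖ v`.

Proof of the reduction: extend a functional `c'` on `F ∖ {v}` by `c = c' + t·𝟙_v`; its values are `t + c'(A∖v)` on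
`A`, `t + c'(B∖v)` on `B` (and `c'(A∖v) + c'(B∖v) = total(c')`), and `c'(J)` on the edges avoiding `v`; playing
`t = 0, 1, 2` against admissibility of `P` forces the required edges into `P ∖ v`.
-/

namespace Summit.MatrixMultiplication.MatrixMultiplication.Theorems

open Finset

universe u

variable {W : Type u} [DecidableEq W]

/-- The two-point functional `a·𝟙_u + b·𝟙_w`. -/
def soloBlindFn2 (u w : W) (a b : ZMod 3) : W → ZMod 3 :=
  fun x => if x = u then a else if x = w then b else 0

/-- Values of the two-point functional. -/
theorem soloBlind_fn2_val {u w : W} (huw : u ≠ w) (a b : ZMod 3) (J : Finset W) :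
    soloBlindHgVal (soloBlindFn2 u w a b) J = (if u ∈ J then a else 0) + (if w ∈ J then b else 0) :=
  soloBlind_hgVal_two huw a b J

/-- Total of the two-point functional. -/
theorem soloBlind_fn2_total {F : Finset W} {u w : W} (hu : u ∈ F) (hw : w ∈ F) (huw : u ≠ w)
    (a b : ZMod 3) : ∑ x ∈ F, soloBlindFn2 u w a b x = a + b := by
  have hsplit : ∀ x ∈ F, soloBlindFn2 u w a b x = (if x = u then a else 0) + (if x = w then b else 0) := by
    intro x _
    unfold soloBlindFn2
    by_cases hxu : x = u
    · rw [if_pos hxu, if_pos hxu, if_neg (fun h => huw (hxu.symm.trans h)), add_zero]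
    · rw [if_neg hxu, if_neg hxu, zero_add]
  rw [Finset.sum_congr rfl hsplit, Finset.sum_add_distrib, Finset.sum_ite_eq' F u (fun _ => a),
    Finset.sum_ite_eq' F w (fun _ => b), if_pos hu, if_pos hw]

omit [DecidableEq W] in
/-- Truth table: `𝟙 + 2·𝟙 = 1` iff only the first indicator is on. -/
theorem soloBlind_tt_12_one (p q : Prop) [Decidable p] [Decidable q] :
    (if p then (1 : ZMod 3) else 0) + (if q then (2 : ZMod 3) else 0) = 1 ↔ p ∧ ¬ q := by
  by_cases hp : p <;> by_cases hq : q <;> simp [hp, hq]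
  all_goals decide

omit [DecidableEq W] in
/-- Truth table: `𝟙 + 2·𝟙 = 2` iff only the second indicator is on. -/
theorem soloBlind_tt_12_two (p q : Prop) [Decidable p] [Decidable q] :
    (if p then (1 : ZMod 3) else 0) + (if q then (2 : ZMod 3) else 0) = 2 ↔ q ∧ ¬ p := by
  by_cases hp : p <;> by_cases hq : q <;> simp [hp, hq]
  all_goals decide

omit [DecidableEq W] in
/-- Truth table: `2·𝟙 + 2·𝟙 = 1` iff both indicators are on. -/
theorem soloBlind_tt_22_one (p q : Prop) [Decidable p] [Decidable q] :
    (if p then (2 : ZMod 3) else 0) + (if q then (2 : ZMod 3) else 0) = 1 ↔ p ∧ q := by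
  by_cases hp : p <;> by_cases hq : q <;> simp [hp, hq]
  all_goals decide

omit [DecidableEq W] in
/-- Truth table: `𝟙 + 𝟙 = 1` iff exactly one indicator is on. -/
theorem soloBlind_tt_11_one (p q : Prop) [Decidable p] [Decidable q] :
    (if p then (1 : ZMod 3) else 0) + (if q then (1 : ZMod 3) else 0) = 1 ↔ ¬ (p ↔ q) := by
  by_cases hp : p <;> by_cases hq : q <;> simp [hp, hq]

/-- STRONG SEPARATION: an edge through `u` avoiding `w`, for every ordered pair. -/
theorem soloBlind_hg_strongSep {F : Finset W} {P : Finset (Finset W)} (hadm : soloBlindHgAdmissible F P)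
    {u w : W} (hu : u ∈ F) (hw : w ∈ F) (huw : u ≠ w) : ∃ J ∈ P, u ∈ J ∧ w ∉ J := by
  obtain ⟨hsep, _, h0⟩ := hadm
  have htot : ∑ x ∈ F, soloBlindFn2 u w 1 2 x = 0 := by
    rw [soloBlind_fn2_total hu hw huw]; decide
  have hiff := h0 _ htot
  simp only [soloBlind_fn2_val huw, soloBlind_tt_12_one, soloBlind_tt_12_two] at hiff
  obtain ⟨J, hJ, hJsep⟩ := hsep u hu w hw huw
  by_cases huJ : u ∈ J
  · exact ⟨J, hJ, huJ, fun hwJ => hJsep ⟨fun _ => hwJ, fun _ => huJ⟩⟩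
  · have hwJ : w ∈ J := by
      by_contra hwJ
      exact hJsep ⟨fun h => absurd h huJ, fun h => absurd h hwJ⟩
    exact hiff.mpr ⟨J, hJ, hwJ, huJ⟩

/-- COVERING: an edge through both `u` and `w`. -/
theorem soloBlind_hg_cover {F : Finset W} {P : Finset (Finset W)} (hadm : soloBlindHgAdmissible F P)
    {u w : W} (hu : u ∈ F) (hw : w ∈ F) (huw : u ≠ w) : ∃ J ∈ P, u ∈ J ∧ w ∈ J := by
  obtain ⟨_, h1, _⟩ := hadm
  have htot : ∑ x ∈ F, soloBlindFn2 u w 2 2 x = 1 := by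
    rw [soloBlind_fn2_total hu hw huw]; decide
  obtain ⟨J, hJ, hv⟩ := h1 _ htot
  rw [soloBlind_fn2_val huw, soloBlind_tt_22_one] at hv
  exact ⟨J, hJ, hv⟩

/-- DEGREES ARE AT LEAST `2` (as soon as there are two vertices). -/
theorem soloBlind_hg_two_le_deg {F : Finset W} {P : Finset (Finset W)} (hadm : soloBlindHgAdmissible F P)
    {u w : W} (hu : u ∈ F) (hw : w ∈ F) (huw : u ≠ w) : 2 ≤ soloBlindHgDeg P u :=
  soloBlind_hg3_deg_two (soloBlind_hg_cover hadm hu hw huw) (soloBlind_hg_strongSep hadm hu hw huw)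

/-- STRUCTURE AT A DEGREE-`2` VERTEX: the two edges `A, B` through `v` meet only in `v` and cover `F`. -/
theorem soloBlind_hg_degTwo_structure {F : Finset W} {P : Finset (Finset W)}
    (hadm : soloBlindHgAdmissible F P) {v : W} (hv : v ∈ F) (hdeg : soloBlindHgDeg P v = 2) :
    ∃ A ∈ P, ∃ B ∈ P, A ≠ B ∧ v ∈ A ∧ v ∈ B ∧ (∀ J ∈ P, v ∈ J → J = A ∨ J = B) ∧
      (∀ u ∈ F, u ≠ v → (u ∈ A ↔ u ∉ B)) := by
  unfold soloBlindHgDeg at hdeg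
  obtain ⟨A, B, hAB, hS⟩ := Finset.card_eq_two.mp hdeg
  have hA : A ∈ P.filter (fun J => v ∈ J) := by rw [hS]; simp
  have hB : B ∈ P.filter (fun J => v ∈ J) := by rw [hS]; simp
  rw [Finset.mem_filter] at hA hB
  have honly : ∀ J ∈ P, v ∈ J → J = A ∨ J = B := by
    intro J hJ hvJ
    have : J ∈ P.filter (fun J => v ∈ J) := Finset.mem_filter.mpr ⟨hJ, hvJ⟩
    rw [hS] at this
    simpa using this
  refine ⟨A, hA.1, B, hB.1, hAB, hA.2, hB.2, honly, ?_⟩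
  intro u hu huv
  obtain ⟨J, hJ, hvJ, huJ⟩ := soloBlind_hg_strongSep hadm hv hu huv.symm
  obtain ⟨J', hJ', hvJ', huJ'⟩ := soloBlind_hg_cover hadm hv hu huv.symm
  rcases honly J hJ hvJ with rfl | rfl <;> rcases honly J' hJ' hvJ' with rfl | rfl
  · exact absurd huJ' huJ
  · exact ⟨fun h => absurd h huJ, fun _ => absurd huJ' (fun h => by simp_all)⟩
  · exact ⟨fun _ => huJ, fun _ => huJ'⟩
  · exact absurd huJ' huJ

/-- The extension `c' + t·𝟙_v` of a functional (the value of `c'` at `v` is overwritten by `t`). -/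
def soloBlindExtFn (v : W) (t : ZMod 3) (c' : W → ZMod 3) : W → ZMod 3 :=
  fun x => if x = v then t else c' x

/-- Sum of the extension over a set containing `v`. -/
theorem soloBlind_ext_sum {S : Finset W} {v : W} (hvS : v ∈ S) (t : ZMod 3) (c' : W → ZMod 3) :
    ∑ x ∈ S, soloBlindExtFn v t c' x = t + ∑ x ∈ S.erase v, c' x := by
  rw [← Finset.add_sum_erase S _ hvS]
  congr 1
  · simp [soloBlindExtFn]
  · exact Finset.sum_congr rfl (fun x hx => by simp [soloBlindExtFn, Finset.ne_of_mem_erase hx])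

/-- Value of the extension on an edge avoiding `v`. -/
theorem soloBlind_ext_val_of_not_mem {J : Finset W} {v : W} (hvJ : v ∉ J) (t : ZMod 3) (c' : W → ZMod 3) :
    soloBlindHgVal (soloBlindExtFn v t c') J = soloBlindHgVal c' J := by
  unfold soloBlindHgVal
  exact Finset.sum_congr rfl (fun x hx => by
    simp [soloBlindExtFn, show x ≠ v from fun h => hvJ (h ▸ hx)])

/-- Value of the extension on an edge through `v`. -/
theorem soloBlind_ext_val_of_mem {J : Finset W} {v : W} (hvJ : v ∈ J) (t : ZMod 3) (c' : W → ZMod 3) :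
    soloBlindHgVal (soloBlindExtFn v t c') J = t + soloBlindHgVal c' (J.erase v) := by
  unfold soloBlindHgVal
  exact soloBlind_ext_sum hvJ t c'

/-- At a degree-`2` vertex the traces `A ∖ v`, `B ∖ v` partition `F ∖ v`: the values add up to the total. -/
theorem soloBlind_degTwo_split {F : Finset W} {P : Finset (Finset W)} (hPF : ∀ J ∈ P, J ⊆ F) {v : W}
    {A B : Finset W} (hA : A ∈ P) (hB : B ∈ P) (hpart : ∀ u ∈ F, u ≠ v → (u ∈ A ↔ u ∉ B))
    (c' : W → ZMod 3) :
    soloBlindHgVal c' (A.erase v) + soloBlindHgVal c' (B.erase v) = ∑ x ∈ F.erase v, c' x := by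
  unfold soloBlindHgVal
  have hdisj : Disjoint (A.erase v) (B.erase v) := by
    rw [Finset.disjoint_left]
    intro x hxA hxB
    rw [Finset.mem_erase] at hxA hxB
    exact (hpart x (hPF A hA hxA.2) hxA.1).mp hxA.2 hxB.2
  rw [← Finset.sum_union hdisj]
  apply Finset.sum_congr _ (fun _ _ => rfl)
  ext x
  simp only [Finset.mem_union, Finset.mem_erase]
  constructor
  · rintro (⟨hxv, hxA⟩ | ⟨hxv, hxB⟩)
    · exact ⟨hxv, hPF A hA hxA⟩
    · exact ⟨hxv, hPF B hB hxB⟩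
  · rintro ⟨hxv, hxF⟩
    by_cases hxA : x ∈ A
    · exact Or.inl ⟨hxv, hxA⟩
    · right
      refine ⟨hxv, ?_⟩
      by_contra hxB
      exact hxA ((hpart x hxF hxv).mpr hxB)

/-- THE DEGREE-2 REDUCTION LEMMA: deleting a degree-`2` vertex together with its two edges leaves an
admissible hypergraph on the remaining vertices. -/
theorem soloBlind_hg_degTwo_admissible {F : Finset W} {P : Finset (Finset W)} (hPF : ∀ J ∈ P, J ⊆ F)
    (hadm : soloBlindHgAdmissible F P) {v : W} (hv : v ∈ F) (hdeg : soloBlindHgDeg P v = 2) :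
    soloBlindHgAdmissible (F.erase v) (P.filter (fun J => v ∉ J)) := by
  obtain ⟨A, hA, B, hB, hAB, hvA, hvB, honly, hpart⟩ := soloBlind_hg_degTwo_structure hadm hv hdeg
  have hsep := hadm.1
  have h1 := hadm.2.1
  have h0 := hadm.2.2
  have hsplit := soloBlind_degTwo_split hPF hA hB hpart
  -- an edge of `P` other than `A`, `B` avoids `v`
  have avoid : ∀ J ∈ P, J ≠ A → J ≠ B → J ∈ P.filter (fun J => v ∉ J) := by
    intro J hJ hJA hJB
    refine Finset.mem_filter.mpr ⟨hJ, fun hvJ => ?_⟩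
    rcases honly J hJ hvJ with h | h
    · exact hJA h
    · exact hJB h
  -- values of the extension `c' + t𝟙_v`
  have valA : ∀ (t : ZMod 3) (c' : W → ZMod 3),
      soloBlindHgVal (soloBlindExtFn v t c') A = t + soloBlindHgVal c' (A.erase v) :=
    fun t c' => soloBlind_ext_val_of_mem hvA t c'
  have valB : ∀ (t : ZMod 3) (c' : W → ZMod 3),
      soloBlindHgVal (soloBlindExtFn v t c') B = t + soloBlindHgVal c' (B.erase v) :=
    fun t c' => soloBlind_ext_val_of_mem hvB t c'
  have tot : ∀ (t : ZMod 3) (c' : W → ZMod 3),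
      ∑ x ∈ F, soloBlindExtFn v t c' x = t + ∑ x ∈ F.erase v, c' x :=
    fun t c' => soloBlind_ext_sum hv t c'
  -- an edge of prescribed `c`-value which is not `A` or `B` is an edge of `P ∖ v` with the same `c'`-value
  have transfer : ∀ (t : ZMod 3) (c' : W → ZMod 3) (k : ZMod 3),
      soloBlindHgVal (soloBlindExtFn v t c') A ≠ k → soloBlindHgVal (soloBlindExtFn v t c') B ≠ k →
      (∃ J ∈ P, soloBlindHgVal (soloBlindExtFn v t c') J = k) →
      ∃ J ∈ P.filter (fun J => v ∉ J), soloBlindHgVal c' J = k := by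
    intro t c' k hkA hkB ⟨J, hJ, hJk⟩
    have hJA : J ≠ A := fun h => hkA (h ▸ hJk)
    have hJB : J ≠ B := fun h => hkB (h ▸ hJk)
    have hJ' := avoid J hJ hJA hJB
    refine ⟨J, hJ', ?_⟩
    rwa [soloBlind_ext_val_of_not_mem (Finset.mem_filter.mp hJ').2] at hJk
  -- (iii'), direction value 2 ⟹ value 1, for every total-0 functional
  have two_to_one : ∀ c' : W → ZMod 3, ∑ x ∈ F.erase v, c' x = 0 →
      (∃ J ∈ P.filter (fun J => v ∉ J), soloBlindHgVal c' J = 2) →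
      ∃ J ∈ P.filter (fun J => v ∉ J), soloBlindHgVal c' J = 1 := by
    intro c' hc0 ⟨J₂, hJ₂, hJ₂v⟩
    have hJ₂P := (Finset.mem_filter.mp hJ₂)
    have hab : soloBlindHgVal c' (A.erase v) + soloBlindHgVal c' (B.erase v) = 0 := by rw [hsplit c', hc0]
    have k1 : ∀ a b : ZMod 3, a + b = 0 → a = 1 → b = 2 := by decide
    have k2 : ∀ a b : ZMod 3, a + b = 0 → b = 1 → a = 2 := by decide
    -- t = 0
    have htot0 : ∑ x ∈ F, soloBlindExtFn v 0 c' x = 0 := by rw [tot, hc0, add_zero]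
    have hex2 : ∃ J ∈ P, soloBlindHgVal (soloBlindExtFn v 0 c') J = 2 :=
      ⟨J₂, hJ₂P.1, by rw [soloBlind_ext_val_of_not_mem hJ₂P.2]; exact hJ₂v⟩
    obtain ⟨J₁, hJ₁, hJ₁v⟩ := (h0 _ htot0).mpr hex2
    have htot1 : ∑ x ∈ F, soloBlindExtFn v 1 c' x = 1 := by rw [tot, hc0, add_zero]
    by_cases hJ₁A : J₁ = A
    · -- a = 1, b = 2: use t = 1 (values 2 on A, 0 on B)
      rw [hJ₁A, valA, zero_add] at hJ₁v
      have hbv := k1 _ _ hab hJ₁v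
      exact transfer 1 c' 1 (by rw [valA, hJ₁v]; decide) (by rw [valB, hbv]; decide) (h1 _ htot1)
    by_cases hJ₁B : J₁ = B
    · rw [hJ₁B, valB, zero_add] at hJ₁v
      have hav := k2 _ _ hab hJ₁v
      exact transfer 1 c' 1 (by rw [valA, hav]; decide) (by rw [valB, hJ₁v]; decide) (h1 _ htot1)
    · have hJ₁' := avoid J₁ hJ₁ hJ₁A hJ₁B
      exact ⟨J₁, hJ₁', by rwa [soloBlind_ext_val_of_not_mem (Finset.mem_filter.mp hJ₁').2] at hJ₁v⟩
  refine ⟨?_, ?_, ?_⟩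
  · -- (i') separation
    intro u hu w hw huw
    rw [Finset.mem_erase] at hu hw
    by_cases huA : u ∈ A <;> by_cases hwA : w ∈ A
    · -- both in A (hence not in B): the strongly separating edge avoids v
      obtain ⟨J, hJ, huJ, hwJ⟩ := soloBlind_hg_strongSep hadm hu.2 hw.2 huw
      have hJA : J ≠ A := fun h => hwJ (h ▸ hwA)
      have hJB : J ≠ B := fun h => ((hpart u hu.2 hu.1).mp huA) (h ▸ huJ)
      exact ⟨J, avoid J hJ hJA hJB, fun h => hwJ (h.mp huJ)⟩
    · -- u ∈ A, w ∈ B: functional 2𝟙_v + 𝟙_u + 𝟙_w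
      have hwB : w ∈ B := by by_contra h; exact hwA ((hpart w hw.2 hw.1).mpr h)
      have huB : u ∉ B := (hpart u hu.2 hu.1).mp huA
      have htot1 : ∑ x ∈ F, soloBlindExtFn v 2 (soloBlindFn2 u w 1 1) x = 1 := by
        rw [tot, soloBlind_fn2_total (Finset.mem_erase.mpr hu) (Finset.mem_erase.mpr hw) huw]; decide
      have hvalA : soloBlindHgVal (soloBlindExtFn v 2 (soloBlindFn2 u w 1 1)) A ≠ 1 := by
        rw [valA, soloBlind_fn2_val huw]
        simp [Finset.mem_erase, huA, hwA, hu.1]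
        decide
      have hvalB : soloBlindHgVal (soloBlindExtFn v 2 (soloBlindFn2 u w 1 1)) B ≠ 1 := by
        rw [valB, soloBlind_fn2_val huw]
        simp [Finset.mem_erase, huB, hwB, hw.1]
        decide
      obtain ⟨J, hJ', hJv⟩ := transfer 2 _ 1 hvalA hvalB (h1 _ htot1)
      rw [soloBlind_fn2_val huw, soloBlind_tt_11_one] at hJv
      exact ⟨J, hJ', hJv⟩
    · -- u ∈ B, w ∈ A: symmetric
      have huB : u ∈ B := by by_contra h; exact huA ((hpart u hu.2 hu.1).mpr h)
      have hwB : w ∉ B := (hpart w hw.2 hw.1).mp hwA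
      have htot1 : ∑ x ∈ F, soloBlindExtFn v 2 (soloBlindFn2 u w 1 1) x = 1 := by
        rw [tot, soloBlind_fn2_total (Finset.mem_erase.mpr hu) (Finset.mem_erase.mpr hw) huw]; decide
      have hvalA : soloBlindHgVal (soloBlindExtFn v 2 (soloBlindFn2 u w 1 1)) A ≠ 1 := by
        rw [valA, soloBlind_fn2_val huw]
        simp [Finset.mem_erase, huA, hwA, hw.1]
        decide
      have hvalB : soloBlindHgVal (soloBlindExtFn v 2 (soloBlindFn2 u w 1 1)) B ≠ 1 := by
        rw [valB, soloBlind_fn2_val huw]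
        simp [Finset.mem_erase, huB, hwB, hu.1]
        decide
      obtain ⟨J, hJ', hJv⟩ := transfer 2 _ 1 hvalA hvalB (h1 _ htot1)
      rw [soloBlind_fn2_val huw, soloBlind_tt_11_one] at hJv
      exact ⟨J, hJ', hJv⟩
    · -- both in B
      have huB : u ∈ B := by by_contra h; exact huA ((hpart u hu.2 hu.1).mpr h)
      obtain ⟨J, hJ, huJ, hwJ⟩ := soloBlind_hg_strongSep hadm hu.2 hw.2 huw
      have hJB : J ≠ B := fun h => hwJ (h ▸ (by by_contra h'; exact hwA ((hpart w hw.2 hw.1).mpr h')))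
      have hJA : J ≠ A := fun h => huA (h ▸ huJ)
      exact ⟨J, avoid J hJ hJA hJB, fun h => hwJ (h.mp huJ)⟩
  · -- (ii') total 1 ⟹ an edge of value 1
    intro c' hc1
    have hab : soloBlindHgVal c' (A.erase v) + soloBlindHgVal c' (B.erase v) = 1 := by rw [hsplit c', hc1]
    have k1 : ∀ a b : ZMod 3, a + b = 1 → a = 1 → b = 0 := by decide
    have k2 : ∀ a b : ZMod 3, a + b = 1 → b = 1 → a = 0 := by decide
    have htot0 : ∑ x ∈ F, soloBlindExtFn v 0 c' x = 1 := by rw [tot, hc1, zero_add]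
    have htot2 : ∑ x ∈ F, soloBlindExtFn v 2 c' x = 0 := by rw [tot, hc1]; decide
    obtain ⟨J, hJ, hJv⟩ := h1 _ htot0
    by_cases hJA : J = A
    · -- a = 1, b = 0: with t = 2 the values are 0 on A and 2 on B, so a value-1 edge avoiding v exists
      rw [hJA, valA, zero_add] at hJv
      have hbv := k1 _ _ hab hJv
      have hex2 : ∃ J ∈ P, soloBlindHgVal (soloBlindExtFn v 2 c') J = 2 :=
        ⟨B, hB, by rw [valB, hbv]; decide⟩
      exact transfer 2 c' 1 (by rw [valA, hJv]; decide) (by rw [valB, hbv]; decide)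
        ((h0 _ htot2).mpr hex2)
    by_cases hJB : J = B
    · rw [hJB, valB, zero_add] at hJv
      have hav := k2 _ _ hab hJv
      have hex2 : ∃ J ∈ P, soloBlindHgVal (soloBlindExtFn v 2 c') J = 2 :=
        ⟨A, hA, by rw [valA, hav]; decide⟩
      exact transfer 2 c' 1 (by rw [valA, hav]; decide) (by rw [valB, hJv]; decide)
        ((h0 _ htot2).mpr hex2)
    · have hJ' := avoid J hJ hJA hJB
      exact ⟨J, hJ', by rwa [soloBlind_ext_val_of_not_mem (Finset.mem_filter.mp hJ').2] at hJv⟩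
  · -- (iii') total 0: value 1 somewhere iff value 2 somewhere
    intro c' hc0
    constructor
    · -- apply `two_to_one` to `2c'`
      rintro ⟨J, hJ', hJv⟩
      have hd0 : ∑ x ∈ F.erase v, (fun x => 2 * c' x) x = 0 := by
        rw [← Finset.mul_sum, hc0, mul_zero]
      have hdval : ∀ J, soloBlindHgVal (fun x => 2 * c' x) J = 2 * soloBlindHgVal c' J := by
        intro J; unfold soloBlindHgVal; rw [Finset.mul_sum]
      obtain ⟨J', hJ'', hJ'v⟩ := two_to_one _ hd0 ⟨J, hJ', by rw [hdval, hJv]; decide⟩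
      rw [hdval] at hJ'v
      refine ⟨J', hJ'', ?_⟩
      generalize soloBlindHgVal c' J' = y at hJ'v
      revert hJ'v; revert y; decide
    · exact two_to_one c' hc0

end Summit.MatrixMultiplication.MatrixMultiplication.Theorems
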